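import Mathlib
import Summits.ABC.ABC.Statement

/-!
# Stub `stub_pillaiWindow` of line `Sketch` — crux `IneffectiveSubspace.DepthCountedABC` (stmt-ABC-14938)

THE WINDOW OF `PolyPillai` (certificate, c22).  The entry-level sub-crux of the cell `ω₅(abc) ≤ 2` is the polynomial
generalized Pillai bound `PolyPillai N`: some `C > 0` with `s^w·v' ≤ C·(r·s·a·u·v')^N` for all primes `r, s` and all
positive coprime configurations `a + r^v·u = s^w·v'`.  This file pins its window over `ℕ`:

* (i) `ABC ⟹ PolyPillai N` for every `N ≥ 2`: the configuration is an abc triple `(a, r^v·u, s^w·v')` with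
  `rad ≤ a·(r·u)·(s·v') = r·s·a·u·v' =: M`, so abc at `ε = 1` gives `s^w·v' < C·rad² ≤ C·M² ≤ C·M^N`.
* (ii) `PolyPillai N` is FALSE for `N ≤ 1`: lifting the exponent at `3` gives `4^(3^k) = 3^(k+1)·t + 1` with `t > 0`,
  so `1 + 3^(k+1)·t = 2^(2·3^k)·1` is an admissible configuration (`r = 3`, `s = 2`, `a = v' = 1`, `u = t`) with
  `r·s·a·u·v' = 6t`; the bound `4^(3^k) ≤ C·(6t)^N ≤ 6·C·t` forces `3^(k+1)·t < 6·C·t`, i.e. `3^(k+1) < 6C` for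
  every `k` — absurd.  Hence the window `[2, ∞)` / `[0, 1]` is SHARP over `ℕ`.

Sources: skeleton `Cruxes/DepthCountedABC/Lines/Sketch.lean` (stub `stub_pillaiWindow`); `ABC_iff`
(`Summits.ABC.ABC.Statement`).  Mathlib only otherwise (`UniqueFactorizationMonoid.radical_mul_dvd`,
`radical_pow_dvd`, `Nat.radical_le_self_iff`, `Nat.radical_pos`, `Real.rpow_natCast`, `pow_unbounded_of_one_lt`).
-/

-- `Summit.<Summit>.<Problem>` is the mandated summit-side namespace (CONVENTIONS §2); for the
-- single-conjunct summit `ABC` the two coincide, so the duplicate `ABC.ABC` is deliberate.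
set_option linter.dupNamespace false

namespace Summit.ABC.ABC.Theorems.DepthCountedABC

open UniqueFactorizationMonoid (radical) in
/-- `radical (p^k · m) ≤ p · m` for positive naturals `p, m` (the radical of a power divides the radical of the
base). [folklore] -/
private theorem pillaiWindow_radical_pow_mul_le {p k m : ℕ} (hp : 0 < p) (hm : 0 < m) :
    radical (p ^ k * m) ≤ p * m := by
  have h1 : radical (p ^ k * m) ≤ radical (p ^ k) * radical m :=
    Nat.le_of_dvd (by positivity) UniqueFactorizationMonoid.radical_mul_dvd
  have h2 : radical (p ^ k) ≤ radical p :=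
    Nat.le_of_dvd (by positivity) UniqueFactorizationMonoid.radical_pow_dvd
  have h3 : radical p ≤ p := Nat.radical_le_self_iff.mpr hp.ne'
  have h4 : radical m ≤ m := Nat.radical_le_self_iff.mpr hm.ne'
  calc radical (p ^ k * m) ≤ radical (p ^ k) * radical m := h1
    _ ≤ p * m := Nat.mul_le_mul (h2.trans h3) h4

open UniqueFactorizationMonoid (radical) in
open Literature.NumberTheory.DiophantineGeometry (IsABCTriple rad rad_def) in
/-- Part (i) of the window: abc (at `ε = 1`) gives the polynomial generalized Pillai bound with every exponent
`N ≥ 2`, since `rad(a · r^v u · s^w v') ≤ r·s·a·u·v'`. [folklore reduction] -/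
private theorem pillaiWindow_of_abc (habc : _root_.ABC) (N : ℕ) (hN : 2 ≤ N) :
    ∃ C : ℝ, 0 < C ∧ ∀ r s a u v' v w : ℕ, r.Prime → s.Prime → 0 < a → 0 < u → 0 < v' →
      a + r ^ v * u = s ^ w * v' → Nat.Coprime (r ^ v * u) (s ^ w * v') →
      ((s ^ w * v' : ℕ) : ℝ) ≤ C * ((r * s * a * u * v' : ℕ) : ℝ) ^ N := by
  obtain ⟨C, hCpos, hC⟩ := ABC_iff.mp habc 1 one_pos
  refine ⟨C, hCpos, ?_⟩
  intro r s a u v' v w hr hs ha hu hv' hsum hcop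
  set b : ℕ := r ^ v * u with hb
  set c : ℕ := s ^ w * v' with hc
  have hrpos : 0 < r := hr.pos
  have hspos : 0 < s := hs.pos
  have hbpos : 0 < b := by positivity
  have hab : Nat.Coprime a b := by
    have h1 : Nat.Coprime b (a + b) := by rw [hsum]; exact hcop
    exact (Nat.coprime_add_self_right.mp h1).symm
  have habc3 : IsABCTriple a b c := ⟨ha, hbpos, hsum, hab⟩
  have hlt := hC a b c habc3
  -- `rad(abc) ≤ r·s·a·u·v'`
  set R : ℕ := rad a b c with hR
  set M : ℕ := r * s * a * u * v' with hM
  have hRle : R ≤ M := by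
    have hra : radical a ≤ a := Nat.radical_le_self_iff.mpr ha.ne'
    have hrb : radical b ≤ r * u := pillaiWindow_radical_pow_mul_le hrpos hu
    have hrc : radical c ≤ s * v' := pillaiWindow_radical_pow_mul_le hspos hv'
    have h2 : radical (a * b * c) ≤ radical (a * b) * radical c :=
      Nat.le_of_dvd (by positivity) UniqueFactorizationMonoid.radical_mul_dvd
    have h3 : radical (a * b) ≤ radical a * radical b :=
      Nat.le_of_dvd (by positivity) UniqueFactorizationMonoid.radical_mul_dvd
    calc R = radical (a * b * c) := rad_def a b c
      _ ≤ radical a * radical b * radical c := h2.trans (Nat.mul_le_mul_right _ h3)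
      _ ≤ a * (r * u) * (s * v') := Nat.mul_le_mul (Nat.mul_le_mul hra hrb) hrc
      _ = M := by rw [hM]; ring
  have hR1 : 1 ≤ R := by rw [hR, rad_def]; exact Nat.radical_pos _
  -- real bookkeeping
  have hM1 : (1 : ℝ) ≤ (M : ℝ) := by exact_mod_cast hR1.trans hRle
  have hRM : (R : ℝ) ≤ (M : ℝ) := by exact_mod_cast hRle
  have hR0 : (0 : ℝ) ≤ (R : ℝ) := by positivity
  rw [show ((1 : ℝ) + 1) = ((2 : ℕ) : ℝ) by norm_num, Real.rpow_natCast] at hlt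
  calc (c : ℝ) ≤ C * (R : ℝ) ^ 2 := hlt.le
    _ ≤ C * (M : ℝ) ^ 2 := mul_le_mul_of_nonneg_left (pow_le_pow_left₀ hR0 hRM 2) hCpos.le
    _ ≤ C * (M : ℝ) ^ N := mul_le_mul_of_nonneg_left (pow_le_pow_right₀ hM1 hN) hCpos.le

/-- Lifting the exponent at `3`: `4^(3^k) = 3^(k+1)·t + 1` with `t > 0`. [folklore] -/
private theorem pillaiWindow_four_pow_three_pow (k : ℕ) : ∃ t : ℕ, 0 < t ∧ 4 ^ 3 ^ k = 3 ^ (k + 1) * t + 1 := by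
  induction k with
  | zero => exact ⟨1, one_pos, by norm_num⟩
  | succ k ih =>
    obtain ⟨t, ht, h⟩ := ih
    refine ⟨t + 3 * (3 ^ k * t ^ 2 + 3 ^ (2 * k) * t ^ 3), by positivity, ?_⟩
    rw [pow_succ, pow_mul, h]; ring

/-- Part (ii) of the window: for `N ≤ 1` the polynomial generalized Pillai bound fails, witnessed by the
configurations `1 + 3^(k+1)·t = 2^(2·3^k)·1` (`r = 3`, `s = 2`, `a = v' = 1`). [folklore] -/
private theorem pillaiWindow_not_of_le_one (N : ℕ) (hN : N ≤ 1) :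
    ¬ ∃ C : ℝ, 0 < C ∧ ∀ r s a u v' v w : ℕ, r.Prime → s.Prime → 0 < a → 0 < u → 0 < v' →
      a + r ^ v * u = s ^ w * v' → Nat.Coprime (r ^ v * u) (s ^ w * v') →
      ((s ^ w * v' : ℕ) : ℝ) ≤ C * ((r * s * a * u * v' : ℕ) : ℝ) ^ N := by
  rintro ⟨C, hCpos, hC⟩
  -- an exponent `n` with `6C < 3^n`, and the configuration at level `n`
  obtain ⟨n, hn⟩ := pow_unbounded_of_one_lt (6 * C) (by norm_num : (1 : ℝ) < 3)
  obtain ⟨t, htpos, ht⟩ := pillaiWindow_four_pow_three_pow n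
  have h4 : 4 ^ 3 ^ n = 2 ^ (2 * 3 ^ n) := by rw [pow_mul]; norm_num
  have hsum : 1 + 3 ^ (n + 1) * t = 2 ^ (2 * 3 ^ n) * 1 := by rw [mul_one, ← h4, ht]; ring
  have hcop : Nat.Coprime (3 ^ (n + 1) * t) (2 ^ (2 * 3 ^ n) * 1) := by
    rw [← hsum]
    exact Nat.coprime_add_self_right.mpr (Nat.coprime_one_right _)
  have key := hC 3 2 1 t 1 (n + 1) (2 * 3 ^ n) Nat.prime_three Nat.prime_two one_pos htpos one_pos hsum hcop
  -- real bookkeeping: `3^(n+1)·t + 1 ≤ C·(6t)^N ≤ 6·C·t < 3^n·t ≤ 3^(n+1)·t`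
  have ht0 : (0 : ℝ) < (t : ℝ) := by exact_mod_cast htpos
  have h6t : (1 : ℝ) ≤ ((3 * 2 * 1 * t * 1 : ℕ) : ℝ) := by
    have : 1 ≤ 3 * 2 * 1 * t * 1 := by omega
    exact_mod_cast this
  have hpowN : ((3 * 2 * 1 * t * 1 : ℕ) : ℝ) ^ N ≤ ((3 * 2 * 1 * t * 1 : ℕ) : ℝ) := by
    calc ((3 * 2 * 1 * t * 1 : ℕ) : ℝ) ^ N ≤ ((3 * 2 * 1 * t * 1 : ℕ) : ℝ) ^ 1 := pow_le_pow_right₀ h6t hN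
      _ = _ := pow_one _
  have hX : ((2 ^ (2 * 3 ^ n) * 1 : ℕ) : ℝ) = (3 : ℝ) ^ (n + 1) * t + 1 := by
    rw [← hsum]; push_cast; ring
  have h1 : (3 : ℝ) ^ (n + 1) * t + 1 ≤ 6 * C * (t : ℝ) := by
    calc (3 : ℝ) ^ (n + 1) * t + 1 = ((2 ^ (2 * 3 ^ n) * 1 : ℕ) : ℝ) := hX.symm
      _ ≤ C * ((3 * 2 * 1 * t * 1 : ℕ) : ℝ) ^ N := key
      _ ≤ C * ((3 * 2 * 1 * t * 1 : ℕ) : ℝ) := mul_le_mul_of_nonneg_left hpowN hCpos.le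
      _ = 6 * C * (t : ℝ) := by push_cast; ring
  have h2 : 6 * C * (t : ℝ) < (3 : ℝ) ^ n * t := mul_lt_mul_of_pos_right hn ht0
  have h3 : (3 : ℝ) ^ n * t ≤ (3 : ℝ) ^ (n + 1) * t :=
    mul_le_mul_of_nonneg_right (pow_le_pow_right₀ (by norm_num) (Nat.le_succ n)) ht0.le
  linarith

/-- **Stub `stub_pillaiWindow` (window of `PolyPillai`, certificate c22) of line `Sketch`, crux `DepthCountedABC`
(stmt-ABC-14938):** (i) abc gives the polynomial generalized Pillai bound `s^w·v' ≤ C·(r·s·a·u·v')^N` — over all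
primes `r, s` and positive coprime configurations `a + r^v·u = s^w·v'` — for every `N ≥ 2`; (ii) the bound is
false for every `N ≤ 1` (witness `1 + 3^(k+1)·t = 4^(3^k)`).  The window is sharp over `ℕ`. [folklore reduction] -/
theorem stub_pillaiWindow :
    (_root_.ABC → ∀ N : ℕ, 2 ≤ N →
      ∃ C : ℝ, 0 < C ∧ ∀ r s a u v' v w : ℕ, r.Prime → s.Prime → 0 < a → 0 < u → 0 < v' →
        a + r ^ v * u = s ^ w * v' → Nat.Coprime (r ^ v * u) (s ^ w * v') →
        ((s ^ w * v' : ℕ) : ℝ) ≤ C * ((r * s * a * u * v' : ℕ) : ℝ) ^ N) ∧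
    (∀ N : ℕ, N ≤ 1 →
      ¬ ∃ C : ℝ, 0 < C ∧ ∀ r s a u v' v w : ℕ, r.Prime → s.Prime → 0 < a → 0 < u → 0 < v' →
        a + r ^ v * u = s ^ w * v' → Nat.Coprime (r ^ v * u) (s ^ w * v') →
        ((s ^ w * v' : ℕ) : ℝ) ≤ C * ((r * s * a * u * v' : ℕ) : ℝ) ^ N) :=
  ⟨pillaiWindow_of_abc, pillaiWindow_not_of_le_one⟩

end Summit.ABC.ABC.Theorems.DepthCountedABC
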